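import Literature.Topology.FourManifolds.LatticeFormsAnisotropic
import Literature.Topology.FourManifolds.LatticeFormsRepresentsZero
import Literature.NumberTheory.QuadraticForms.Meyer
import Literature.NumberTheory.QuadraticForms.MeyerProofs
import HarnessLib

/-!
# Indefinite unimodular lattices represent zero: reduction to Meyer's theorem

Trunk T-4MAN; proofs file for the named fact `LinearMap.BilinForm.exists_isotropic_of_isIndefinite`
of `LatticeFormsRepresentsZero.lean` — Serre, *A Course in Arithmetic*, Ch. V §2.2 **Theorem 3**:
"If `E ∈ S` is indefinite, `E` represents zero". Everything here is proved; the main result is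
*conditional* on Meyer's theorem, vendored as the named fact
`Literature.NumberTheory.QuadraticForms.meyer` (Serre, Ch. IV §3.2 Cor. 2: an indefinite
nondegenerate rational quadratic form of rank `≥ 5` represents `0`).

Following Serre's proof (Ch. V §3.1) in its case distinction:

* ranks `≤ 5` are settled unconditionally in `LatticeFormsAnisotropic.lean`
  (`exists_isotropic_of_isIndefinite_of_finrank_le_five`, by reduction theory — Serre uses
  `d = -1` for `n = 2` and Hasse–Minkowski for `n = 3, 4`);
* rank `≥ 5` (`exists_isotropic_of_five_le_finrank`): "One applies Meyer's theorem" — the Gram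
  matrix `G = (B(bᵢ,bⱼ))` in a basis is an integral symmetric matrix with `det G = ±1`, the
  rational form `ᵗv G v` takes both signs (it does so on integral vectors,
  `isIndefinite_iff_exists_neg_pos_of_isUnimodular`), so by `meyer` it has a rational zero
  `v ≠ 0`, and clearing denominators (`exists_int_eq_smul`) gives an integral one.

Assembly: `exists_isotropic_of_isIndefinite_of_meyer : meyer → exists_isotropic_of_isIndefinite`
(any universe; the arbitrary `Module ℤ V` instance of the named fact is the canonical one,
`Subsingleton (Module ℤ V)`). The discharge `exists_isotropic_of_isIndefinite_holds` will follow
verbatim from a proof of `meyer` (Hasse–Minkowski, Ch. IV §3.2 Thm 8, with Ch. IV §2.2 Thm 6).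

## Sources

* J.-P. Serre, *A Course in Arithmetic* (GTM 7, Springer 1973), Ch. V §2.2 Thm 3, §3.1 (iv)
  (PDF pp. 50, 52–53); Ch. IV §3.2 Thm 8, Cor. 2 (pp. 39–41). [Serre1973]
-/

open Module
open LinearMap (BilinForm)
open Literature.NumberTheory.QuadraticForms

universe u

namespace LinearMap.BilinForm

variable {M : Type u} [AddCommGroup M]

/-! ### The rational quadratic form of a lattice in a basis -/

/-- Expansion of an integral bilinear form in a basis: `B(x, y) = ∑ᵢⱼ xᵢ Gᵢⱼ yⱼ` with
`G = (B(bᵢ, bⱼ))` the Gram matrix and `xᵢ = b.repr x i`. [folklore] -/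
theorem apply_eq_sum_sum_toMatrix {n : ℕ} (b : Basis (Fin n) ℤ M) (B : BilinForm ℤ M) (x y : M) :
    B x y = ∑ i, ∑ j, b.repr x i * LinearMap.BilinForm.toMatrix b B i j * b.repr y j := by
  conv_lhs => rw [← b.sum_repr x, ← b.sum_repr y]
  rw [LinearMap.BilinForm.sum_left]
  refine Finset.sum_congr rfl fun i _ => ?_
  rw [LinearMap.BilinForm.sum_right]
  refine Finset.sum_congr rfl fun j _ => ?_
  rw [LinearMap.BilinForm.smul_left, LinearMap.BilinForm.smul_right,
    LinearMap.BilinForm.toMatrix_apply]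
  ring

/-- The rational form `ᵗv G v` of the Gram matrix `G`, evaluated on the (rational images of the)
coordinates of `x, y`, is `B(x, y)` ("let `V = E ⊗ ℚ` be the corresponding `ℚ`-vector space",
Serre, Ch. V §3.1). [folklore] -/
theorem toBilin'_map_toMatrix_repr {n : ℕ} (b : Basis (Fin n) ℤ M) (B : BilinForm ℤ M) (x y : M) :
    Matrix.toBilin' ((LinearMap.BilinForm.toMatrix b B).map (Int.castRingHom ℚ))
      (fun i => (b.repr x i : ℚ)) (fun j => (b.repr y j : ℚ)) = (B x y : ℚ) := by
  rw [Matrix.toBilin'_apply, apply_eq_sum_sum_toMatrix b B x y]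
  push_cast
  simp [Matrix.map_apply]

/-- The rational form of the Gram matrix on rational multiples of integral vectors:
`ᵗ(c v) G (c v) = c² · B(x, x)` for `v` the coordinate vector of `x`. [folklore] -/
theorem toBilin'_map_toMatrix_smul_repr {n : ℕ} (b : Basis (Fin n) ℤ M) (B : BilinForm ℤ M)
    (c : ℚ) (x : M) :
    Matrix.toBilin' ((LinearMap.BilinForm.toMatrix b B).map (Int.castRingHom ℚ))
      (c • fun i => (b.repr x i : ℚ)) (c • fun i => (b.repr x i : ℚ)) = c * c * (B x x : ℚ) := by
  rw [LinearMap.BilinForm.smul_left, LinearMap.BilinForm.smul_right, toBilin'_map_toMatrix_repr,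
    mul_assoc]

/-- **Clearing denominators**: a rational vector is a rational multiple `D⁻¹ • w` of an integral
vector, `D ≥ 1` (the product of the denominators). [folklore] -/
theorem exists_int_eq_smul {n : ℕ} (v : Fin n → ℚ) :
    ∃ (D : ℕ) (w : Fin n → ℤ), 0 < D ∧ (fun i => (w i : ℚ)) = (D : ℚ) • v := by
  set D : ℕ := ∏ i, (v i).den with hD
  have key : ∀ i, ∃ z : ℤ, (z : ℚ) = (D : ℚ) * v i := fun i => by
    obtain ⟨k, hk⟩ : (v i).den ∣ D := Finset.dvd_prod_of_mem _ (Finset.mem_univ i)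
    refine ⟨k * (v i).num, ?_⟩
    rw [hk]
    push_cast
    rw [← Rat.mul_den_eq_num (v i)]
    ring
  choose w hw using key
  exact ⟨D, w, Finset.prod_pos fun i _ => (v i).den_pos, funext fun i => by simp [hw]⟩

/-! ### Rank `≥ 5`: Meyer's theorem -/

/-- **Theorem 3 in rank `≥ 5`, from Meyer's theorem** (Serre, *A Course in Arithmetic*, Ch. V
§3.1 (iv): "`n ≥ 5`. One applies Meyer's theorem"). For a symmetric unimodular indefinite lattice
`E` of rank `n ≥ 5` with Gram matrix `G` (`det G = ±1`) in a basis, the rational form `ᵗv G v` is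
nondegenerate of rank `≥ 5` and takes both signs, so (`meyer`) it has a zero `v ≠ 0` in `ℚⁿ`;
`D v` is then an integral isotropic vector. [cite: Serre1973, Ch. V §3.1] -/
theorem exists_isotropic_of_five_le_finrank (hM : meyer) [Module.Finite ℤ M] [Module.Free ℤ M]
    {B : BilinForm ℤ M} (hB : B.IsSymm) (hu : B.IsUnimodular) (hind : B.IsIndefinite)
    (h5 : 5 ≤ finrank ℤ M) : ∃ x : M, x ≠ 0 ∧ B x x = 0 := by
  classical
  set n := finrank ℤ M with hn
  let b : Basis (Fin n) ℤ M := Module.finBasis ℤ M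
  set G : Matrix (Fin n) (Fin n) ℤ := LinearMap.BilinForm.toMatrix b B with hG
  set A : Matrix (Fin n) (Fin n) ℚ := G.map (Int.castRingHom ℚ) with hA
  -- `A` is symmetric with `det A = det G = ±1 ≠ 0`
  have hGs : G.IsSymm := Matrix.IsSymm.ext fun i j => by
    simp only [hG, LinearMap.BilinForm.toMatrix_apply]
    exact hB.eq _ _
  have hAs : A.IsSymm := hGs.map _
  have hdet : A.det ≠ 0 := by
    have h1 : G.det.natAbs = 1 :=
      Int.isUnit_iff_natAbs_eq.mp ((isUnimodular_iff_isUnit_det_holds B b).mp hu)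
    have h2 : A.det = (G.det : ℚ) := by rw [hA, ← RingHom.mapMatrix_apply, ← RingHom.map_det]; rfl
    rw [h2, Int.cast_ne_zero]
    intro h0
    rw [h0, Int.natAbs_zero] at h1
    exact zero_ne_one h1
  -- both signs, on integral vectors
  obtain ⟨⟨x, hx⟩, ⟨y, hy⟩⟩ := (isIndefinite_iff_exists_neg_pos_of_isUnimodular hB hu).mp hind
  have hpos : ∃ v : Fin n → ℚ, 0 < Matrix.toBilin' A v v :=
    ⟨fun i => (b.repr y i : ℚ), by rw [toBilin'_map_toMatrix_repr]; exact_mod_cast hy⟩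
  have hneg : ∃ w : Fin n → ℚ, Matrix.toBilin' A w w < 0 :=
    ⟨fun i => (b.repr x i : ℚ), by rw [toBilin'_map_toMatrix_repr]; exact_mod_cast hx⟩
  -- Meyer: a rational zero; clear denominators
  obtain ⟨v, hv0, hv⟩ := hM A h5 hAs hdet hpos hneg
  obtain ⟨D, w, hD, hw⟩ := exists_int_eq_smul v
  -- the integral vector `z = ∑ wᵢ bᵢ`
  let z : M := b.equivFun.symm w
  have hzw : ∀ i, b.repr z i = w i := fun i => by
    rw [← b.equivFun_apply, LinearEquiv.apply_symm_apply]
  have hw0 : w ≠ 0 := by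
    intro h0
    apply hv0
    have : (D : ℚ) • v = 0 := by rw [← hw, h0]; ext i; simp
    exact (smul_eq_zero.mp this).resolve_left (Nat.cast_ne_zero.mpr hD.ne')
  refine ⟨z, fun hz0 => hw0 ?_, ?_⟩
  · ext i
    rw [← hzw i, hz0, map_zero, Finsupp.zero_apply, Pi.zero_apply]
  · have h := toBilin'_map_toMatrix_smul_repr b B (D : ℚ) z
    have hcoord : ((D : ℚ) • fun i => (b.repr z i : ℚ)) = (D : ℚ) • ((D : ℚ) • v) := by
      rw [← hw]
      ext i
      simp [hzw]
    rw [hcoord, LinearMap.BilinForm.smul_left, LinearMap.BilinForm.smul_right,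
      LinearMap.BilinForm.smul_left, LinearMap.BilinForm.smul_right, hv, mul_zero, mul_zero,
      mul_zero, mul_zero] at h
    have hD0 : (D : ℚ) * D ≠ 0 := by positivity
    exact_mod_cast (mul_eq_zero.mp h.symm).resolve_left hD0

/-! ### Assembly: Theorem 3 from Meyer's theorem -/

/-- **Serre's Theorem 3 from Meyer's theorem** (canonical `ℤ`-module structure): a symmetric
unimodular indefinite lattice represents zero — ranks `≤ 5` unconditionally
(`exists_isotropic_of_isIndefinite_of_finrank_le_five`), ranks `≥ 5` by `meyer`
(`exists_isotropic_of_five_le_finrank`). Serre, *A Course in Arithmetic*, Ch. V §2.2 Thm 3,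
proof §3.1. [cite: Serre1973, Ch. V §2.2 Thm 3] -/
theorem exists_isotropic_of_isIndefinite_of_meyer' (hM : meyer) [Module.Finite ℤ M]
    [Module.Free ℤ M] {B : BilinForm ℤ M} (hB : B.IsSymm) (hu : B.IsUnimodular)
    (hind : B.IsIndefinite) : ∃ x : M, x ≠ 0 ∧ B x x = 0 := by
  by_cases h5 : finrank ℤ M ≤ 5
  · exact exists_isotropic_of_isIndefinite_of_finrank_le_five hB hu hind h5
  · exact exists_isotropic_of_five_le_finrank hM hB hu hind (by omega)

/-- **Serre's Theorem 3 from Meyer's theorem**: `meyer → exists_isotropic_of_isIndefinite` (the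
named fact of `LatticeFormsRepresentsZero.lean`, in any universe, for the arbitrary `Module ℤ V`
instance it quantifies over — which is the canonical one, `Subsingleton (Module ℤ V)`). Serre,
*A Course in Arithmetic*, Ch. V §2.2 Thm 3 ("If `E ∈ S` is indefinite, `E` represents zero"),
proof §3.1: `n ≤ 5` by `LatticeFormsAnisotropic.lean`, `n ≥ 5` by Meyer's theorem (Ch. IV §3.2
Cor. 2). The unconditional discharge awaits a proof of `meyer` (Hasse–Minkowski).
[cite: Serre1973, Ch. V §2.2 Thm 3] -/
theorem exists_isotropic_of_isIndefinite_of_meyer (hM : meyer) :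
    exists_isotropic_of_isIndefinite.{u} := by
  intro V _ _ _ _ Q hs hu hi
  have hV := Subsingleton.elim ‹Module ℤ V› (AddCommGroup.toIntModule V)
  subst hV
  exact exists_isotropic_of_isIndefinite_of_meyer' hM hs hu hi

/-! ### The discharge of Theorem 3 -/

/-- **Serre's Theorem 3** (discharge of the named fact `exists_isotropic_of_isIndefinite` of
`LatticeFormsRepresentsZero.lean`): every symmetric unimodular indefinite lattice (finitely
generated free `ℤ`-module, any universe) represents zero — "If `E ∈ S` is indefinite, `E`
represents zero", Serre, *A Course in Arithmetic*, Ch. V §2.2 Thm 3, proof §3.1: ranks `≤ 5` by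
reduction theory (`LatticeFormsAnisotropic.lean`), ranks `≥ 5` by Meyer's theorem, now proved
(`Literature.NumberTheory.QuadraticForms.meyer_holds`, `MeyerProofs.lean`: Hasse–Minkowski over
`ℚ`, Ch. IV §3.2 Thm 8 and Cor. 2). [cite: Serre1973, Ch. V §2.2 Thm 3] -/
theorem exists_isotropic_of_isIndefinite_holds : exists_isotropic_of_isIndefinite.{u} :=
  exists_isotropic_of_isIndefinite_of_meyer Literature.NumberTheory.QuadraticForms.meyer_holds

end LinearMap.BilinForm
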